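import Literature.MathematicalPhysics.QuantumFieldTheory.Balaban1983to89.B3WT226Derivative
import Literature.MathematicalPhysics.QuantumFieldTheory.Balaban1983to89.B3WTWick

/-!
# `Balaban1983to89.B3WT226Traces` — T. Bałaban, *(Higgs)₂,₃ quantum fields in a finite volume. III. Renormalization*,
# Commun. Math. Phys. **88** (1983) 411–445 [Balaban1983Higgs3], (2.26) p. 431, RIGHT MEMBER: the four trace terms and the
# identity (2.26) itself ON THE CONCRETE LATTICE MODEL

statement-level skeleton of published theorems with citation tags; proofs where landed; nothing here is a claim about the Yang–Mills mass gap

Page 431 [PDF 21] (image render `run/shared/lean/pub/pub-balaban/b2b-balaban-ref1/pages/1983-cmp88-higgs23-III/…-p021-x2.png`),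
verbatim: *"Taking F = 1, differentiating with respect to A and next taking A = 0 and using the identity (2.25), we get*
  `∫dμ_{C^η_{M²}}(φ)[(−e_k⟨∂^ηφ, Aqφ⟩)(:⟨∂^ηφ, ∂^ηλqφ⟩:) − e_k⟨φ, A·∂^ηλq²φ⟩ − e_k⟨∂^ηφ, ηA∂^ηλq²φ⟩]`
  `= −e_kΣ_{b,b'}η^{2d}A_b tr q(C^η_{M²}∂^{η*})(b₋,b')q(C^η_{M²}∂^{η*})(b'₋,b)(∂^ηλ)(b') + e_kΣ_{b,b'}η^{2d}A_b tr qC^η_{M²}(b₋,b'₋)q(∂^ηC^η_{M²}∂^{η*})(b',b)(∂^ηλ)(b')`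
  `− e_kΣ_bη^dA_b(∂^ηλ)(b) tr q²C^η_{M²}(0) − e_kΣ_bη^dηA_b(∂^ηλ)(b) tr q²(C^η_{M²}∂^η)(b₋,b) = 0, (2.26)"*.
THIS FILE completes row **B3.Eq2.26-2.28**'s (2.26) for the lattice model of `…B3WT223Instance` … `…B3WTWick` (fields
`φ : T^{(j)} → R^N`, `U(A) = exp(qηeA)`, weight `w = η^d`, lattice factor `c = η⁻¹`, propagator `C^η_{M²} = B3WTPropagator.G`):
* the printed kernels `(C^η_{M²}∂^{η*})(x,b) = (C^η_{M²}∂^η)(x,b) := c(C(x,b₊) − C(x,b₋))` (`kerCD`; the contraction of `φ(x)` with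
  `(∂^ηφ)(b)`) and `(∂^ηC^η_{M²}∂^{η*})(b',b) := c²(C(b'₊,b₊) − C(b'₊,b₋) − C(b'₋,b₊) + C(b'₋,b₋))` (`kerDCD`), and the four printed
  terms `R1 … R4` (`term1 … term4`), scalar kernels times `tr q²` (`tr q(X)q(Y) = XY·tr q²` for scalar `X, Y`);
* `eq226_wick` — **the Gaussian evaluation**: `∫dμ_{C^η_{M²}}[LEFT integrand] = R1 + R2 + R3 + R4`, from the covariance
  (`B3WTCovariance.moment2_op`) for the single-propagator terms and the `q`-contraction (`B3WTWick.moment_qq`, Wick's theorem with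
  vanishing self-contractions = the normal ordering and (2.25)) for the two-propagator terms;
* `eq226` — **(2.26) as printed: `R1 + R2 + R3 + R4 = 0`**, combining `eq226_wick` with the vanishing of the left member
  (`B3WT226Derivative.eq226_deriv`, the `A`-derivative of (2.24)).
Reading conventions (all docstring-visible): `C^η_{M²}(0)` of the third printed term is `B3WTCovariance.C0`, the value of the
propagator at coinciding points (translation invariance `C(x,x) = C(0)`: `B3WTCovariance.G_diag`); the charge normalisation is
`cη·e` for the print's `e_k` (`cη = 1` in print); the direction of differentiation is `B` (print: `A`).
Phase-2 RESERVE R11 (part 2b) of `PHASE2-TARGETS.md` §G.3; cell `lit-balaban`, seat p39 (gen 2, unit `lit-balaban-p39`), HOME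
`run/shared/lean/pub/lit-balaban/`.  Nothing beyond these lattice identities is asserted; no new `Prop` is introduced.
-/

noncomputable section

open scoped BigOperators InnerProductSpace

namespace Literature.MathematicalPhysics.QuantumFieldTheory.Balaban1983to89.B3WT226Traces

open _root_.MeasureTheory Matrix
open LatticeFieldCalculus B3WT223Instance B3WT224Instance B3WT226Pairings B3WT226Derivative B3WTPropagator B3WTCovariance B3WTWick

variable {P : Params} {j N : ℕ} (C : HiggsLattice.ChargeData N) (η w c M2 : ℝ)

/-! ## §1 The printed kernels and the four printed terms -/

/-- `(C^η_{M²}∂^{η*})(x,b) = (C^η_{M²}∂^η)(x,b) := c(C^η_{M²}(x,b₊) − C^η_{M²}(x,b₋))` — the contraction of `φ(x)` with `(∂^ηφ)(b)`.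
[cite: Balaban1983Higgs3, (2.26) p.431] -/
def kerCD (x : Site P j) (b : PBond P j) : ℝ := c * (G w c M2 x b.tgt - G w c M2 x b.src)

/-- `(∂^ηC^η_{M²}∂^{η*})(b',b) := c²(C(b'₊,b₊) − C(b'₊,b₋) − C(b'₋,b₊) + C(b'₋,b₋))` — the contraction of `(∂^ηφ)(b')` with `(∂^ηφ)(b)`.
[cite: Balaban1983Higgs3, (2.26) p.431] -/
def kerDCD (b' b : PBond P j) : ℝ :=
  c ^ 2 * (G w c M2 b'.tgt b.tgt - G w c M2 b'.tgt b.src - G w c M2 b'.src b.tgt + G w c M2 b'.src b.src)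

/-- first printed term `R1 = −cηe Σ_{b,b'} η^{2d} B_b tr[q(C∂^{η*})(b₋,b')q(C∂^{η*})(b'₋,b)](∂^ηλ)(b')` (`tr[qXqY] = XY·tr q²`).
[cite: Balaban1983Higgs3, (2.26) p.431] -/
def term1 (B : VecField P j ℝ) (lam : Site P j → ℝ) : ℝ :=
  -(c * η * C.e) * ∑ b : PBond P j, ∑ b' : PBond P j,
    w ^ 2 * (B b * (trE (C.q.comp C.q) * (kerCD w c M2 b.src b' * kerCD w c M2 b'.src b)) * grad c lam b')

/-- second printed term `R2 = +cηe Σ_{b,b'} η^{2d} B_b tr[qC(b₋,b'₋)q(∂^ηC∂^{η*})(b',b)](∂^ηλ)(b')`. [cite: Balaban1983Higgs3, (2.26) p.431] -/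
def term2 (B : VecField P j ℝ) (lam : Site P j → ℝ) : ℝ :=
  (c * η * C.e) * ∑ b : PBond P j, ∑ b' : PBond P j,
    w ^ 2 * (B b * (trE (C.q.comp C.q) * (G w c M2 b.src b'.src * kerDCD w c M2 b' b)) * grad c lam b')

/-- third printed term `R3 = −cηe Σ_b η^d B_b(∂^ηλ)(b) tr q² C^η_{M²}(0)`. [cite: Balaban1983Higgs3, (2.26) p.431] -/
def term3 (B : VecField P j ℝ) (lam : Site P j → ℝ) : ℝ :=
  -(c * η * C.e) * ∑ b : PBond P j, w * (B b * grad c lam b * (trE (C.q.comp C.q) * C0 (P := P) (j := j) w c M2))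

/-- fourth printed term `R4 = −ηe Σ_b η^d B_b(∂^ηλ)(b) tr q²(C^η_{M²}∂^η)(b₋,b)`. [cite: Balaban1983Higgs3, (2.26) p.431] -/
def term4 (B : VecField P j ℝ) (lam : Site P j → ℝ) : ℝ :=
  -(η * C.e) * ∑ b : PBond P j, w * (B b * grad c lam b * (trE (C.q.comp C.q) * kerCD w c M2 b.src b))

/-! ## §2 The pairings as sums of elementary contractions -/

/-- `⟨∂^ηφ, Bqφ⟩ = −Σ_b η^d B_b c ⟪φ(b₋), qφ(b₊)⟫` (`⟪u,qu⟫ = 0`). [cite: Balaban1983Higgs3, (2.26) p.431] -/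
theorem curJ_expand (B : VecField P j ℝ) (φ : Cfg P j N) :
    curJ C w c B φ = ∑ b : PBond P j, -(w * B b * c) * ⟪φ b.src, C.q (φ b.tgt)⟫_ℝ := by
  unfold curJ
  refine Finset.sum_congr rfl fun b _ => ?_
  have hg : grad c φ b = c • (φ b.tgt - φ b.src) := rfl
  rw [hg, real_inner_smul_left, real_inner_smul_right, inner_sub_left, inner_q_self]
  ring

/-- `⟨∂^ηφ, ∂^ηλqφ⟩ = −Σ_b η^d (∂^ηλ)(b) c ⟪φ(b₋), qφ(b₊)⟫`. [cite: Balaban1983Higgs3, (2.25) p.431] -/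
theorem pairD_expand (lam : Site P j → ℝ) (φ : Cfg P j N) :
    pairD C w c lam φ = ∑ b : PBond P j, -(w * grad c lam b * c) * ⟪φ b.src, C.q (φ b.tgt)⟫_ℝ := by
  unfold pairD
  refine Finset.sum_congr rfl fun b _ => ?_
  have hg : grad c φ b = c • (φ b.tgt - φ b.src) := rfl
  rw [hg, real_inner_smul_left, real_inner_smul_right, inner_sub_left, inner_q_self]
  ring

/-- the product `⟨∂^ηφ,Bqφ⟩⟨∂^ηφ,∂^ηλqφ⟩` as a double sum of products of contractions. [cite: Balaban1983Higgs3, (2.26) p.431] -/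
theorem curJ_mul_pairD_expand (B : VecField P j ℝ) (lam : Site P j → ℝ) (φ : Cfg P j N) :
    curJ C w c B φ * pairD C w c lam φ = ∑ b : PBond P j, ∑ b' : PBond P j,
      (w * B b * c) * (w * grad c lam b' * c) * (⟪φ b.src, C.q (φ b.tgt)⟫_ℝ * ⟪φ b'.src, C.q (φ b'.tgt)⟫_ℝ) := by
  rw [curJ_expand, pairD_expand, Finset.sum_mul_sum]
  refine Finset.sum_congr rfl fun b _ => Finset.sum_congr rfl fun b' _ => ?_
  ring

/-- `⟨∂^ηφ, B∂^ηλq²φ⟩ = Σ_b η^d B_b(∂^ηλ)(b)(c⟪φ(b₊),q²φ(b₋)⟫ − c⟪φ(b₋),q²φ(b₋)⟫)`. [cite: Balaban1983Higgs3, (2.26) p.431] -/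
theorem derQ_expand (B : VecField P j ℝ) (lam : Site P j → ℝ) (φ : Cfg P j N) :
    derQ C w c B lam φ = ∑ b : PBond P j, (w * (B b * grad c lam b) * c * ⟪φ b.tgt, (C.q.comp C.q) (φ b.src)⟫_ℝ
      - w * (B b * grad c lam b) * c * ⟪φ b.src, (C.q.comp C.q) (φ b.src)⟫_ℝ) := by
  unfold derQ
  refine Finset.sum_congr rfl fun b _ => ?_
  have hg : grad c φ b = c • (φ b.tgt - φ b.src) := rfl
  rw [hg, real_inner_smul_left, inner_sub_left, ContinuousLinearMap.comp_apply]
  ring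

/-! ## §3 The Gaussian evaluation of the three integrals -/

/-- positivity of the Gaussian normalisation `Z = ∫dφ e^{−½⟨φ,Kφ⟩} > 0`. [cite: Balaban1983Higgs3, (2.25) p.431] -/
theorem Z_pos (hw : 0 < w) (hM : 0 < M2) : 0 < ∫ φ, weight C η w c M2 (0 : VecField P j ℝ) φ := by
  have hint : Integrable (fun φ : Cfg P j N => weight C η w c M2 (0 : VecField P j ℝ) φ) := by
    have h := integrable_weight_mul (P := P) (j := j) (N := N) C η w c M2 hw hM (g := fun _ => (1 : ℝ)) continuous_const
      (K := 1) (κ := 0) (fun φ => by rw [abs_one, zero_mul, Real.exp_zero, mul_one])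
    simpa only [mul_one] using h
  rw [integral_pos_iff_support_of_nonneg (fun φ => (weight_pos (C := C) (η := η) (w := w) (c := c) (M2 := M2) _ φ).le) hint]
  have hsupp : Function.support (fun φ : Cfg P j N => weight C η w c M2 (0 : VecField P j ℝ) φ) = Set.univ :=
    Set.eq_univ_iff_forall.mpr fun φ =>
      Function.mem_support.mpr (weight_pos (C := C) (η := η) (w := w) (c := c) (M2 := M2) _ φ).ne'
  rw [hsupp]
  exact isOpen_univ.measure_pos volume Set.univ_nonempty

/-- the integrand `e^{−½⟨φ,Kφ⟩}⟨∂^ηφ,Bqφ⟩⟨∂^ηφ,∂^ηλqφ⟩` as a double sum of weighted contractions. [cite: Balaban1983Higgs3, (2.26) p.431] -/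
theorem weight_mul_curJ_mul_pairD (B : VecField P j ℝ) (lam : Site P j → ℝ) (φ : Cfg P j N) :
    weight C η w c M2 (0 : VecField P j ℝ) φ * (curJ C w c B φ * pairD C w c lam φ) = ∑ b : PBond P j, ∑ b' : PBond P j,
      (w * B b * c) * (w * grad c lam b' * c) *
        (weight C η w c M2 (0 : VecField P j ℝ) φ * (⟪φ b.src, C.q (φ b.tgt)⟫_ℝ * ⟪φ b'.src, C.q (φ b'.tgt)⟫_ℝ)) := by
  rw [curJ_mul_pairD_expand, Finset.mul_sum]
  refine Finset.sum_congr rfl fun b _ => ?_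
  rw [Finset.mul_sum]
  refine Finset.sum_congr rfl fun b' _ => ?_
  ring

/-- **two-propagator terms**: `∫dφ e^{−½⟨φ,Kφ⟩}⟨∂^ηφ,Bqφ⟩⟨∂^ηφ,∂^ηλqφ⟩ = Z·Σ_{b,b'}η^{2d}B_b(∂^ηλ)(b')c²·tr q²·(C(b₋,b'₊)C(b₊,b'₋) − C(b₋,b'₋)C(b₊,b'₊))`
(`B3WTWick.moment_qq` for each pair of bonds). [cite: Balaban1983Higgs3, (2.26) p.431] -/
theorem integral_curJ_mul_pairD (hw : 0 < w) (hM : 0 < M2) (B : VecField P j ℝ) (lam : Site P j → ℝ) :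
    ∫ φ, weight C η w c M2 (0 : VecField P j ℝ) φ * (curJ C w c B φ * pairD C w c lam φ) =
      (∫ φ, weight C η w c M2 (0 : VecField P j ℝ) φ) * ∑ b : PBond P j, ∑ b' : PBond P j,
        (w * B b * c) * (w * grad c lam b' * c) * (trE (C.q.comp C.q) *
          (G w c M2 b.src b'.tgt * G w c M2 b.tgt b'.src - G w c M2 b.src b'.src * G w c M2 b.tgt b'.tgt)) := by
  simp_rw [weight_mul_curJ_mul_pairD]
  rw [integral_finsetSum _ (fun b _ => integrable_finsetSum _ fun b' _ =>
    (integrable_weight_mul_qq C η w c M2 hw hM _ _ _ _).const_mul _), Finset.mul_sum]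
  refine Finset.sum_congr rfl fun b _ => ?_
  rw [integral_finsetSum _ (fun b' _ => (integrable_weight_mul_qq C η w c M2 hw hM _ _ _ _).const_mul _), Finset.mul_sum]
  refine Finset.sum_congr rfl fun b' _ => ?_
  rw [integral_const_mul, moment_qq C η w c M2 hw hM]
  ring

/-- the integrand `e^{−½⟨φ,Kφ⟩}⟨φ,B·∂^ηλq²φ⟩` as a sum of weighted contractions. [cite: Balaban1983Higgs3, (2.26) p.431] -/
theorem weight_mul_locQ (B : VecField P j ℝ) (lam : Site P j → ℝ) (φ : Cfg P j N) :
    weight C η w c M2 (0 : VecField P j ℝ) φ * locQ C w c B lam φ = ∑ b : PBond P j,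
      (w * (B b * grad c lam b)) * (weight C η w c M2 (0 : VecField P j ℝ) φ * ⟪φ b.src, (C.q.comp C.q) (φ b.src)⟫_ℝ) := by
  unfold locQ
  rw [Finset.mul_sum]
  refine Finset.sum_congr rfl fun b _ => ?_
  rw [ContinuousLinearMap.comp_apply]
  ring

/-- **third term**: `∫dφ e^{−½⟨φ,Kφ⟩}⟨φ,B·∂^ηλq²φ⟩ = Z·Σ_bη^dB_b(∂^ηλ)(b)·C(b₋,b₋)·tr q²` (`B3WTCovariance.moment2_op`).
[cite: Balaban1983Higgs3, (2.26) p.431] -/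
theorem integral_locQ (hw : 0 < w) (hM : 0 < M2) (B : VecField P j ℝ) (lam : Site P j → ℝ) :
    ∫ φ, weight C η w c M2 (0 : VecField P j ℝ) φ * locQ C w c B lam φ =
      (∫ φ, weight C η w c M2 (0 : VecField P j ℝ) φ) *
        ∑ b : PBond P j, w * (B b * grad c lam b) * (G w c M2 b.src b.src * trE (C.q.comp C.q)) := by
  simp_rw [weight_mul_locQ]
  rw [integral_finsetSum _ (fun b _ => (integrable_weight_mul_inner_op C η w c M2 hw hM _ _ _).const_mul _), Finset.mul_sum]
  refine Finset.sum_congr rfl fun b _ => ?_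
  rw [integral_const_mul, moment2_op C η w c M2 hw hM]
  ring

/-- the integrand `e^{−½⟨φ,Kφ⟩}⟨∂^ηφ,B∂^ηλq²φ⟩` as a sum of weighted contractions. [cite: Balaban1983Higgs3, (2.26) p.431] -/
theorem weight_mul_derQ (B : VecField P j ℝ) (lam : Site P j → ℝ) (φ : Cfg P j N) :
    weight C η w c M2 (0 : VecField P j ℝ) φ * derQ C w c B lam φ = ∑ b : PBond P j,
      ((w * (B b * grad c lam b) * c) * (weight C η w c M2 (0 : VecField P j ℝ) φ * ⟪φ b.tgt, (C.q.comp C.q) (φ b.src)⟫_ℝ)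
        - (w * (B b * grad c lam b) * c) * (weight C η w c M2 (0 : VecField P j ℝ) φ * ⟪φ b.src, (C.q.comp C.q) (φ b.src)⟫_ℝ)) := by
  rw [derQ_expand, Finset.mul_sum]
  refine Finset.sum_congr rfl fun b _ => ?_
  ring

/-- **fourth term**: `∫dφ e^{−½⟨φ,Kφ⟩}⟨∂^ηφ,B∂^ηλq²φ⟩ = Z·Σ_bη^dB_b(∂^ηλ)(b)·(C∂^η)(b₋,b)·tr q²`. [cite: Balaban1983Higgs3, (2.26) p.431] -/
theorem integral_derQ (hw : 0 < w) (hM : 0 < M2) (B : VecField P j ℝ) (lam : Site P j → ℝ) :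
    ∫ φ, weight C η w c M2 (0 : VecField P j ℝ) φ * derQ C w c B lam φ =
      (∫ φ, weight C η w c M2 (0 : VecField P j ℝ) φ) *
        ∑ b : PBond P j, w * (B b * grad c lam b) * (kerCD w c M2 b.src b * trE (C.q.comp C.q)) := by
  simp_rw [weight_mul_derQ]
  have hI : ∀ b : PBond P j, Integrable (fun φ : Cfg P j N =>
      (w * (B b * grad c lam b) * c) * (weight C η w c M2 (0 : VecField P j ℝ) φ * ⟪φ b.tgt, (C.q.comp C.q) (φ b.src)⟫_ℝ)
        - (w * (B b * grad c lam b) * c) * (weight C η w c M2 (0 : VecField P j ℝ) φ * ⟪φ b.src, (C.q.comp C.q) (φ b.src)⟫_ℝ)) :=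
    fun b => ((integrable_weight_mul_inner_op C η w c M2 hw hM _ _ _).const_mul _).sub
      ((integrable_weight_mul_inner_op C η w c M2 hw hM _ _ _).const_mul _)
  rw [integral_finsetSum _ (fun b _ => hI b), Finset.mul_sum]
  refine Finset.sum_congr rfl fun b _ => ?_
  rw [integral_sub ((integrable_weight_mul_inner_op C η w c M2 hw hM _ _ _).const_mul _)
    ((integrable_weight_mul_inner_op C η w c M2 hw hM _ _ _).const_mul _), integral_const_mul, integral_const_mul,
    moment2_op C η w c M2 hw hM, moment2_op C η w c M2 hw hM, kerCD, G_symm w c M2 b.tgt b.src]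
  ring

/-! ## §4 (2.26) -/

/-- **The Gaussian evaluation of the left member of (2.26)**: with `dμ_{C^η_{M²}} = Z⁻¹e^{−½⟨φ,Kφ⟩}dφ`,
`∫dφ e^{−½⟨φ,Kφ⟩}[(−cηe⟨∂^ηφ,Bqφ⟩)⟨∂^ηφ,∂^ηλqφ⟩ − cηe⟨φ,B·∂^ηλq²φ⟩ − ηe⟨∂^ηφ,B∂^ηλq²φ⟩] = Z·(R1 + R2 + R3 + R4)` — the four
printed trace terms (*"calculating the Gaussian integrals"*). [cite: Balaban1983Higgs3, (2.26) p.431] -/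
theorem eq226_wick (hw : 0 < w) (hM : 0 < M2) (B : VecField P j ℝ) (lam : Site P j → ℝ) :
    ∫ φ, weight C η w c M2 (0 : VecField P j ℝ) φ *
      ((-(c * η * C.e) * curJ C w c B φ) * pairD C w c lam φ - (c * η * C.e) * locQ C w c B lam φ
        - (η * C.e) * derQ C w c B lam φ) =
      (∫ φ, weight C η w c M2 (0 : VecField P j ℝ) φ) *
        (term1 C η w c M2 B lam + term2 C η w c M2 B lam + term3 C η w c M2 B lam + term4 C η w c M2 B lam) := by
  have i1 : Integrable (fun φ => weight C η w c M2 (0 : VecField P j ℝ) φ * (curJ C w c B φ * pairD C w c lam φ)) := by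
    have h := funext (weight_mul_curJ_mul_pairD C η w c M2 B lam)
    rw [h]
    exact integrable_finsetSum _ fun b _ => integrable_finsetSum _ fun b' _ =>
      (integrable_weight_mul_qq C η w c M2 hw hM _ _ _ _).const_mul _
  have i2 : Integrable (fun φ => weight C η w c M2 (0 : VecField P j ℝ) φ * locQ C w c B lam φ) := by
    have h := funext (weight_mul_locQ C η w c M2 B lam)
    rw [h]
    exact integrable_finsetSum _ fun b _ => (integrable_weight_mul_inner_op C η w c M2 hw hM _ _ _).const_mul _
  have i3 : Integrable (fun φ => weight C η w c M2 (0 : VecField P j ℝ) φ * derQ C w c B lam φ) := by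
    have h := funext (weight_mul_derQ C η w c M2 B lam)
    rw [h]
    exact integrable_finsetSum _ fun b _ => ((integrable_weight_mul_inner_op C η w c M2 hw hM _ _ _).const_mul _).sub
      ((integrable_weight_mul_inner_op C η w c M2 hw hM _ _ _).const_mul _)
  have hsplit : (fun φ => weight C η w c M2 (0 : VecField P j ℝ) φ *
      ((-(c * η * C.e) * curJ C w c B φ) * pairD C w c lam φ - (c * η * C.e) * locQ C w c B lam φ
        - (η * C.e) * derQ C w c B lam φ)) = fun φ =>
      -(c * η * C.e) * (weight C η w c M2 (0 : VecField P j ℝ) φ * (curJ C w c B φ * pairD C w c lam φ))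
        - (c * η * C.e) * (weight C η w c M2 (0 : VecField P j ℝ) φ * locQ C w c B lam φ)
        - (η * C.e) * (weight C η w c M2 (0 : VecField P j ℝ) φ * derQ C w c B lam φ) := by
    funext φ
    ring
  have j1 : Integrable (fun φ => -(c * η * C.e) *
      (weight C η w c M2 (0 : VecField P j ℝ) φ * (curJ C w c B φ * pairD C w c lam φ))) := i1.const_mul _
  have j2 : Integrable (fun φ => (c * η * C.e) * (weight C η w c M2 (0 : VecField P j ℝ) φ * locQ C w c B lam φ)) :=
    i2.const_mul _
  have j3 : Integrable (fun φ => (η * C.e) * (weight C η w c M2 (0 : VecField P j ℝ) φ * derQ C w c B lam φ)) :=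
    i3.const_mul _
  have j12 : Integrable (fun φ => -(c * η * C.e) *
      (weight C η w c M2 (0 : VecField P j ℝ) φ * (curJ C w c B φ * pairD C w c lam φ))
        - (c * η * C.e) * (weight C η w c M2 (0 : VecField P j ℝ) φ * locQ C w c B lam φ)) := j1.sub j2
  rw [hsplit, integral_sub j12 j3, integral_sub j1 j2, integral_const_mul, integral_const_mul, integral_const_mul,
    integral_curJ_mul_pairD C η w c M2 hw hM, integral_locQ C η w c M2 hw hM, integral_derQ C η w c M2 hw hM]
  set Z : ℝ := ∫ φ, weight C η w c M2 (0 : VecField P j ℝ) φ with hZ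
  have key : ∀ b b' : PBond P j,
      (w * B b * c) * (w * grad c lam b' * c) * (trE (C.q.comp C.q) *
        (G w c M2 b.src b'.tgt * G w c M2 b.tgt b'.src - G w c M2 b.src b'.src * G w c M2 b.tgt b'.tgt)) * (-(c * η * C.e)) =
      -(c * η * C.e) * (w ^ 2 * (B b * (trE (C.q.comp C.q) * (kerCD w c M2 b.src b' * kerCD w c M2 b'.src b)) * grad c lam b'))
        + (c * η * C.e) * (w ^ 2 * (B b * (trE (C.q.comp C.q) * (G w c M2 b.src b'.src * kerDCD w c M2 b' b)) * grad c lam b')) := by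
    intro b b'
    unfold kerCD kerDCD
    rw [G_symm w c M2 b'.src b.tgt, G_symm w c M2 b'.src b.src, G_symm w c M2 b'.tgt b.tgt, G_symm w c M2 b'.tgt b.src]
    ring
  have hA : (∑ b : PBond P j, ∑ b' : PBond P j, (w * B b * c) * (w * grad c lam b' * c) * (trE (C.q.comp C.q) *
      (G w c M2 b.src b'.tgt * G w c M2 b.tgt b'.src - G w c M2 b.src b'.src * G w c M2 b.tgt b'.tgt))) * (-(c * η * C.e)) =
      term1 C η w c M2 B lam + term2 C η w c M2 B lam := by
    unfold term1 term2
    rw [Finset.sum_mul, Finset.mul_sum, Finset.mul_sum, ← Finset.sum_add_distrib]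
    refine Finset.sum_congr rfl fun b _ => ?_
    rw [Finset.sum_mul, Finset.mul_sum, Finset.mul_sum, ← Finset.sum_add_distrib]
    exact Finset.sum_congr rfl fun b' _ => key b b'
  have hB : (∑ b : PBond P j, w * (B b * grad c lam b) * (G w c M2 b.src b.src * trE (C.q.comp C.q))) * (-(c * η * C.e)) =
      term3 C η w c M2 B lam := by
    unfold term3
    rw [Finset.sum_mul, Finset.mul_sum]
    exact Finset.sum_congr rfl fun b _ => by rw [G_diag]; ring
  have hC : (∑ b : PBond P j, w * (B b * grad c lam b) * (kerCD w c M2 b.src b * trE (C.q.comp C.q))) * (-(η * C.e)) =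
      term4 C η w c M2 B lam := by
    unfold term4
    rw [Finset.sum_mul, Finset.mul_sum]
    exact Finset.sum_congr rfl fun b _ => by ring
  linear_combination Z * hA + Z * hB + Z * hC

/-- **(2.26) p. 431 [PDF 21] AS PRINTED, for the concrete lattice model**: the four trace terms sum to zero,
`−cηeΣ_{b,b'}η^{2d}B_b tr[q(C∂^{η*})(b₋,b')q(C∂^{η*})(b'₋,b)](∂^ηλ)(b') + cηeΣ_{b,b'}η^{2d}B_b tr[qC(b₋,b'₋)q(∂^ηC∂^{η*})(b',b)](∂^ηλ)(b')`
`− cηeΣ_bη^dB_b(∂^ηλ)(b) tr q²C(0) − ηeΣ_bη^dB_b(∂^ηλ)(b) tr q²(C∂^η)(b₋,b) = 0`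
for every direction `B` of the vector field and gauge function `λ` (`η^d = w > 0`, `M² > 0`, `cηe ≠ 0`): the Gaussian evaluation
`eq226_wick` of the left member, which vanishes by `B3WT226Derivative.eq226_deriv` (the `A`-derivative of (2.24) at `A = 0`,
`F = 1`, with (2.25)). [cite: Balaban1983Higgs3, (2.26) p.431] -/
theorem eq226 (hw : 0 < w) (hM : 0 < M2) (hce : c * η * C.e ≠ 0) (B : VecField P j ℝ) (lam : Site P j → ℝ) :
    term1 C η w c M2 B lam + term2 C η w c M2 B lam + term3 C η w c M2 B lam + term4 C η w c M2 B lam = 0 := by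
  have h := (eq226_wick C η w c M2 hw hM B lam).symm.trans (eq226_deriv C η w c M2 hw hM hce B lam)
  exact (mul_eq_zero.mp h).resolve_left (Z_pos C η w c M2 hw hM).ne'

/-- (2.26) with both members, in the normalized measure `dμ_{C^η_{M²}}` of r15's carrier instance (`WTData.meanC` of
`B3WT224Instance.wtModel`) and with the printed normal ordering:
`∫dμ_{C^η_{M²}}[(−cηe⟨∂^ηφ,Bqφ⟩)(:⟨∂^ηφ,∂^ηλqφ⟩:) − cηe⟨φ,B·∂^ηλq²φ⟩ − ηe⟨∂^ηφ,B∂^ηλq²φ⟩] = R1 + R2 + R3 + R4` (and this is `0`,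
`eq226`). [cite: Balaban1983Higgs3, (2.26) p.431] -/
theorem eq226_meanC (hw : 0 < w) (hM : 0 < M2) (hce : c * η * C.e ≠ 0) (A B : VecField P j ℝ) (lam : Site P j → ℝ) :
    (wtModel C η w c M2 A).meanC (fun φ =>
      (-(c * η * C.e) * curJ C w c B φ) * normOrd C η w c M2 (pairD C w c lam) φ - (c * η * C.e) * locQ C w c B lam φ
        - (η * C.e) * derQ C w c B lam φ) =
      term1 C η w c M2 B lam + term2 C η w c M2 B lam + term3 C η w c M2 B lam + term4 C η w c M2 B lam := by
  change (∫ φ, weight C η w c M2 (0 : VecField P j ℝ) φ *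
      ((-(c * η * C.e) * curJ C w c B φ) * normOrd C η w c M2 (pairD C w c lam) φ - (c * η * C.e) * locQ C w c B lam φ
        - (η * C.e) * derQ C w c B lam φ)) / ∫ φ, weight C η w c M2 (0 : VecField P j ℝ) φ = _
  rw [normOrd_pairD C η w c M2 hw hM hce lam, eq226_wick C η w c M2 hw hM B lam, mul_div_cancel_left₀ _ (Z_pos C η w c M2 hw hM).ne']

end Literature.MathematicalPhysics.QuantumFieldTheory.Balaban1983to89.B3WT226Traces

end
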